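import Literature.NumberTheory.ComplexMultiplication.CMTypeRankPartialConjugation
import HarnessLib

/-!
# A SHARED quadratic character forces a rank defect: two slots seeing the same sign character are never additive
# (`Hg(A₀ × A₁) ⊊ Hg(A₀) × Hg(A₁)`: the Weil-type obstruction for CM fields with a common imaginary quadratic subfield)

Companion (and converse direction) of `NumberTheory/ComplexMultiplication/CMTypeRankPartialConjugation` and
`…/CMTypeRankFamilies` (notation: `G` acts on the slots `E_i`, `Φ_i ⊆ E_i`, `Σ = sigmaType Φ`, `U(·) = antiSpan G ·`,
`u_g = antiVec`, `ext_i = slotExt i`; `rank(Σ) − 1 = dim U(Σ) = rank Hg(∏_i A_{Φ_i})`).  Those files give EQUALITY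
`dim U(Σ) = Σ_i dim U(Φ_i)` from partial conjugations.  This file gives the obstruction in the other direction:

* **`finrank_antiSpan_sigmaType_lt_of_shared`** — suppose two slots `i₀ ≠ i₁` carry weights `f₀ : E_{i₀} → ℚ`,
  `f₁ : E_{i₁} → ℚ` transforming under the SAME function `χ : G → ℚ` (`f_k(g • x) = χ(g) f_k(x)`; think of the sign
  `±1` of an embedding on a common imaginary quadratic subfield `k`, `χ(g) = ±1` according as `g` fixes `k ⊂ ℂ` or
  conjugates it), and both pair non-trivially with their types: `c_k = Σ_x u_1(Φ_{i_k})(x) f_k(x) ≠ 0`.  Then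
  `dim U(Σ) < Σ_i dim U(Φ_i)` — STRICTLY.  Proof: the linear form `λ(w) = c₁ Σ_x w(i₀,x) f₀(x) − c₀ Σ_x w(i₁,x) f₁(x)`
  kills every simultaneous translate `u_g(Σ) = (u_g(Φ_i))_i` (both sums pick up the same factor `χ(g⁻¹)`), hence all of
  `U(Σ)`, but `λ(ext_{i₀} u_1(Φ_{i₀})) = c₁ c₀ ≠ 0`, and `ext_{i₀} u_1(Φ_{i₀})` lies in `⊕_i ext_i U(Φ_i) ⊇ U(Σ)`;
* **`typeRank_sigmaType_add_card_lt_of_shared`** — `rank(Σ) + |I| < Σ_i rank(Φ_i) + 1`: the rank is NOT additive;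
* **`typeRank_sigmaType_lt_of_shared`**, **`typeRank_sigmaType_ne_of_shared`** — consequently `Σ` is DEGENERATE
  (`rank(Σ) < |E|/2 + 1`), whatever the members: on abelian varieties, `∏_i A_{Φ_i}` is never stably nondegenerate, even
  when every `A_{Φ_i}` is (Murty's exceptional classes; for CM fields sharing an imaginary quadratic field `k` these are
  the Weil classes of `k` acting on `A_{i₀}^a × A_{i₁}^b`).

For `G = Aut(ℂ)` on `E_i = Hom(K_i, ℂ)` with `K_{i₀}, K_{i₁} ⊇ k` imaginary quadratic and `f_k(φ) = ±1` the sign of `φ|_k`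
(`χ(g) = ±1` the action of `g` on `Hom(k, ℂ)`), `c_k/2 = n⁺_k − n⁻_k` is the SIGNATURE DEFECT of `Φ_{i_k}` on `k`; it is
non-zero e.g. whenever `[K_{i_k} : k]` is odd.  This is the exact complement of the partial-conjugation criterion for such
pairs: `L_{i₀} ∩ L_{i₁} ⊇ k` is not totally real.  (Number-field form: `SharedImaginaryQuadraticDegenerate`.)

Everything is proved; no definition, no named fact, no `sorry`.

## References

* [Gordon1999HodgeAVSurvey] B. B. Gordon, *A survey of the Hodge conjecture for abelian varieties*, §3 Theorem (Imai,
  Murty) and its proof (the character-group computation), 7.5–7.7 (Murty, Hazama: `rank Hg(A) < rdim A` iff some power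
  carries an exceptional class).
* [Deligne1982HodgeCycles] P. Deligne, *Hodge cycles on abelian varieties*, LNM 900 (1982), I Ex. 3.7, §4 (Weil classes).
-/

set_option autoImplicit false

noncomputable section

open scoped BigOperators

namespace Literature.NumberTheory.ComplexMultiplication

variable {G : Type*} [Group G] {I : Type*} {E : I → Type*} [∀ i, MulAction G (E i)]

/-! ### Translating a weight that transforms under `χ` -/

section Pairing

variable {X : Type*} [MulAction G X]

/-- `u_g(x) = u_1(g • x)` (the `±1`-vector of a translate is the translate of the `±1`-vector).
[cite: Gordon1999HodgeAVSurvey, §3 Theorem (proof)] -/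
theorem antiVec_eq_antiVec_one_smul (Ψ : Set X) (g : G) (x : X) : antiVec Ψ g x = antiVec Ψ (1 : G) (g • x) := by
  have h := congrFun (antiVec_comp_smul (G := G) Ψ 1 g) x
  rw [one_mul] at h
  exact h.symm

variable [Fintype X]

/-- **The pairing of a translate with a `χ`-semi-invariant weight**: if `f(g • x) = χ(g) f(x)` then
`Σ_x f(x) u_g(x) = χ(g⁻¹) Σ_x f(x) u_1(x)` (substitute `y = g • x`). [cite: Gordon1999HodgeAVSurvey, §3 Theorem (proof)] -/
theorem sum_mul_antiVec_eq (Ψ : Set X) (χ : G → ℚ) (f : X → ℚ) (hf : ∀ (g : G) (x : X), f (g • x) = χ g * f x)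
    (g : G) : ∑ x, f x * antiVec Ψ g x = χ g⁻¹ * ∑ x, f x * antiVec Ψ (1 : G) x := by
  calc ∑ x, f x * antiVec Ψ g x = ∑ x, χ g⁻¹ * (f (g • x) * antiVec Ψ (1 : G) (g • x)) := by
        refine Finset.sum_congr rfl fun x _ => ?_
        rw [antiVec_eq_antiVec_one_smul Ψ g x, ← mul_assoc, ← hf g⁻¹ (g • x), inv_smul_smul]
    _ = χ g⁻¹ * ∑ x, f (g • x) * antiVec Ψ (1 : G) (g • x) := by rw [Finset.mul_sum]
    _ = χ g⁻¹ * ∑ x, f x * antiVec Ψ (1 : G) x := by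
        congr 1
        exact Equiv.sum_comp (MulAction.toPerm g) (fun y => f y * antiVec Ψ (1 : G) y)

end Pairing

/-! ### The obstruction: a shared character makes the rank defect positive -/

section Shared

variable [DecidableEq I] [Fintype I] [∀ i, Fintype (E i)]

/-- **Two slots seeing the same character are never additive.**  Let `f₀ : E_{i₀} → ℚ`, `f₁ : E_{i₁} → ℚ` (`i₀ ≠ i₁`)
satisfy `f_k(g • x) = χ(g) f_k(x)` for one and the same `χ : G → ℚ`, and `c_k = Σ_x f_k(x) u_1(Φ_{i_k})(x) ≠ 0` for
`k = 0, 1`.  Then `dim U(Σ) < Σ_i dim U(Φ_i)`: the form `c₁ Σ_x f₀(x) w(i₀,x) − c₀ Σ_x f₁(x) w(i₁,x)` vanishes on every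
`u_g(Σ)` (both sums scale by `χ(g⁻¹)`) but not on `ext_{i₀} u_1(Φ_{i₀}) ∈ ⊕_i ext_i U(Φ_i)`.
[cite: Gordon1999HodgeAVSurvey, §3 Theorem (proof) and 7.5] -/
theorem finrank_antiSpan_sigmaType_lt_of_shared (Φ : ∀ i, Set (E i)) {i₀ i₁ : I} (h01 : i₀ ≠ i₁) (χ : G → ℚ)
    (f₀ : E i₀ → ℚ) (f₁ : E i₁ → ℚ) (hf₀ : ∀ (g : G) (x : E i₀), f₀ (g • x) = χ g * f₀ x)
    (hf₁ : ∀ (g : G) (x : E i₁), f₁ (g • x) = χ g * f₁ x)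
    (hc₀ : ∑ x, f₀ x * antiVec (Φ i₀) (1 : G) x ≠ 0) (hc₁ : ∑ x, f₁ x * antiVec (Φ i₁) (1 : G) x ≠ 0) :
    Module.finrank ℚ (antiSpan G (sigmaType Φ)) < ∑ i, Module.finrank ℚ (antiSpan G (Φ i)) := by
  set c₀ := ∑ x, f₀ x * antiVec (Φ i₀) (1 : G) x with hc₀def
  set c₁ := ∑ x, f₁ x * antiVec (Φ i₁) (1 : G) x with hc₁def
  -- the separating linear form
  let L₀ : ((Σ j, E j) → ℚ) →ₗ[ℚ] ℚ := ∑ x : E i₀, f₀ x • LinearMap.proj (⟨i₀, x⟩ : Σ j, E j)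
  let L₁ : ((Σ j, E j) → ℚ) →ₗ[ℚ] ℚ := ∑ x : E i₁, f₁ x • LinearMap.proj (⟨i₁, x⟩ : Σ j, E j)
  let lam : ((Σ j, E j) → ℚ) →ₗ[ℚ] ℚ := c₁ • L₀ - c₀ • L₁
  have hL₀ : ∀ w : (Σ j, E j) → ℚ, L₀ w = ∑ x, f₀ x * w ⟨i₀, x⟩ := fun w => by
    simp only [L₀, LinearMap.sum_apply, LinearMap.smul_apply, LinearMap.proj_apply, smul_eq_mul]
  have hL₁ : ∀ w : (Σ j, E j) → ℚ, L₁ w = ∑ x, f₁ x * w ⟨i₁, x⟩ := fun w => by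
    simp only [L₁, LinearMap.sum_apply, LinearMap.smul_apply, LinearMap.proj_apply, smul_eq_mul]
  have hlam : ∀ w : (Σ j, E j) → ℚ, lam w = c₁ * (∑ x, f₀ x * w ⟨i₀, x⟩) - c₀ * ∑ x, f₁ x * w ⟨i₁, x⟩ := fun w => by
    simp only [lam, LinearMap.sub_apply, LinearMap.smul_apply, hL₀, hL₁, smul_eq_mul]
  -- `λ` kills every simultaneous translate, hence `U(Σ)`
  have hker : antiSpan G (sigmaType Φ) ≤ LinearMap.ker lam := by
    refine Submodule.span_le.2 ?_
    rintro _ ⟨g, rfl⟩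
    rw [SetLike.mem_coe, LinearMap.mem_ker, hlam]
    simp only [antiVec_sigmaType]
    rw [sum_mul_antiVec_eq (Φ i₀) χ f₀ hf₀ g, sum_mul_antiVec_eq (Φ i₁) χ f₁ hf₁ g, ← hc₀def, ← hc₁def]
    ring
  -- `ext_{i₀} u_1(Φ_{i₀})` lies in `⊕_i ext_i U(Φ_i)` but not in `ker λ`
  set W := LinearMap.range (sigmaLift ∘ₗ LinearMap.pi fun i => (antiSpan G (Φ i)).subtype ∘ₗ LinearMap.proj i)
    with hWdef
  have hvW : slotExt i₀ (antiVec (Φ i₀) (1 : G)) ∈ W := by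
    refine ⟨Pi.single i₀ ⟨antiVec (Φ i₀) (1 : G), Submodule.subset_span ⟨1, rfl⟩⟩, ?_⟩
    funext x
    obtain ⟨j, s⟩ := x
    change ((Pi.single (M := fun i => antiSpan G (Φ i)) i₀
      ⟨antiVec (Φ i₀) (1 : G), Submodule.subset_span ⟨1, rfl⟩⟩ j : antiSpan G (Φ j)) : E j → ℚ) s =
      slotExt i₀ (antiVec (Φ i₀) (1 : G)) ⟨j, s⟩
    by_cases hj : j = i₀
    · subst hj
      rw [Pi.single_eq_same, slotExt_apply_same]
    · rw [Pi.single_eq_of_ne hj, slotExt_apply_of_ne hj]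
      rfl
  have hvl : lam (slotExt i₀ (antiVec (Φ i₀) (1 : G))) ≠ 0 := by
    rw [hlam]
    simp only [slotExt_apply_same, slotExt_apply_of_ne h01.symm, mul_zero, Finset.sum_const_zero, sub_zero]
    rw [← hc₀def]
    exact mul_ne_zero hc₁ hc₀
  -- strictness
  have hlt : antiSpan G (sigmaType Φ) < W := by
    refine lt_of_le_of_ne (antiSpan_sigmaType_le_range Φ) fun heq => hvl ?_
    have hv : slotExt i₀ (antiVec (Φ i₀) (1 : G)) ∈ antiSpan G (sigmaType Φ) := by rw [heq]; exact hvW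
    exact LinearMap.mem_ker.1 (hker hv)
  calc Module.finrank ℚ (antiSpan G (sigmaType Φ))
      < Module.finrank ℚ W := Submodule.finrank_lt_finrank_of_lt hlt
    _ ≤ Module.finrank ℚ (∀ i, antiSpan G (Φ i)) := LinearMap.finrank_range_le _
    _ = ∑ i, Module.finrank ℚ (antiSpan G (Φ i)) := Module.finrank_pi_fintype ℚ

/-- **The rank is NOT additive**: `rank(Σ) + |I| < Σ_i rank(Φ_i) + 1`, i.e. `rank(Σ) − 1 < Σ_i (rank(Φ_i) − 1)`
(`rank Hg(∏_i A_i) < Σ_i rank Hg(A_i)`), under a shared character with non-zero pairings.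
[cite: Gordon1999HodgeAVSurvey, §3 Theorem (proof) and 7.5] -/
theorem typeRank_sigmaType_add_card_lt_of_shared [Nonempty I] [∀ i, Nonempty (E i)] {ρ : G}
    {Φ : ∀ i, Set (E i)} (h : ∀ i, IsCMTypeWith ρ (Φ i)) {i₀ i₁ : I} (h01 : i₀ ≠ i₁) (χ : G → ℚ)
    (f₀ : E i₀ → ℚ) (f₁ : E i₁ → ℚ) (hf₀ : ∀ (g : G) (x : E i₀), f₀ (g • x) = χ g * f₀ x)
    (hf₁ : ∀ (g : G) (x : E i₁), f₁ (g • x) = χ g * f₁ x)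
    (hc₀ : ∑ x, f₀ x * antiVec (Φ i₀) (1 : G) x ≠ 0) (hc₁ : ∑ x, f₁ x * antiVec (Φ i₁) (1 : G) x ≠ 0) :
    typeRank G (sigmaType Φ) + Fintype.card I < (∑ i, typeRank G (Φ i)) + 1 := by
  obtain ⟨j₀⟩ := ‹Nonempty I›
  haveI : Nonempty (Σ i, E i) := ⟨⟨j₀, Classical.arbitrary (E j₀)⟩⟩
  rw [(IsCMTypeWith.sigmaType h).typeRank_eq_finrank_antiSpan_add_one,
    Finset.sum_congr rfl fun i _ => (h i).typeRank_eq_finrank_antiSpan_add_one, Finset.sum_add_distrib,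
    Finset.sum_const, Finset.card_univ, smul_eq_mul, mul_one]
  have := finrank_antiSpan_sigmaType_lt_of_shared Φ h01 χ f₀ f₁ hf₀ hf₁ hc₀ hc₁
  omega

/-- **A shared character forces DEGENERACY of the family**: `rank(Σ) < |⊔_i E_i|/2 + 1`, whatever the members (each
`rank(Φ_i) ≤ |E_i|/2 + 1`) — `∏_i A_{Φ_i}` is not stably nondegenerate: some power `∏ A_i^{k_i}` carries an exceptional
Hodge class (Murty), even if every `A_{Φ_i}` is nondegenerate. [cite: Gordon1999HodgeAVSurvey, 7.5–7.7] -/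
theorem typeRank_sigmaType_lt_of_shared [Nonempty I] [∀ i, Nonempty (E i)] {ρ : G} {Φ : ∀ i, Set (E i)}
    (h : ∀ i, IsCMTypeWith ρ (Φ i)) {i₀ i₁ : I} (h01 : i₀ ≠ i₁) (χ : G → ℚ) (f₀ : E i₀ → ℚ) (f₁ : E i₁ → ℚ)
    (hf₀ : ∀ (g : G) (x : E i₀), f₀ (g • x) = χ g * f₀ x) (hf₁ : ∀ (g : G) (x : E i₁), f₁ (g • x) = χ g * f₁ x)
    (hc₀ : ∑ x, f₀ x * antiVec (Φ i₀) (1 : G) x ≠ 0) (hc₁ : ∑ x, f₁ x * antiVec (Φ i₁) (1 : G) x ≠ 0) :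
    typeRank G (sigmaType Φ) < Fintype.card (Σ i, E i) / 2 + 1 := by
  have hlt := typeRank_sigmaType_add_card_lt_of_shared h h01 χ f₀ f₁ hf₀ hf₁ hc₀ hc₁
  have hle : ∀ i, typeRank G (Φ i) ≤ Fintype.card (E i) / 2 + 1 := fun i => (h i).typeRank_le
  have hsum : ∑ i, typeRank G (Φ i) ≤ ∑ i, (Fintype.card (E i) / 2 + 1) := Finset.sum_le_sum fun i _ => hle i
  rw [Finset.sum_add_distrib, Finset.sum_const, Finset.card_univ, smul_eq_mul, mul_one] at hsum
  rw [card_sigma_div_two h]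
  omega

/-- **… so `Σ` is not nondegenerate** (`rank(Σ) ≠ |⊔_i E_i|/2 + 1`): the negation of the conclusion of
`typeRank_sigmaType_eq_iff_forall_of_partialConj`. [cite: Gordon1999HodgeAVSurvey, 7.5–7.7] -/
theorem typeRank_sigmaType_ne_of_shared [Nonempty I] [∀ i, Nonempty (E i)] {ρ : G} {Φ : ∀ i, Set (E i)}
    (h : ∀ i, IsCMTypeWith ρ (Φ i)) {i₀ i₁ : I} (h01 : i₀ ≠ i₁) (χ : G → ℚ) (f₀ : E i₀ → ℚ) (f₁ : E i₁ → ℚ)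
    (hf₀ : ∀ (g : G) (x : E i₀), f₀ (g • x) = χ g * f₀ x) (hf₁ : ∀ (g : G) (x : E i₁), f₁ (g • x) = χ g * f₁ x)
    (hc₀ : ∑ x, f₀ x * antiVec (Φ i₀) (1 : G) x ≠ 0) (hc₁ : ∑ x, f₁ x * antiVec (Φ i₁) (1 : G) x ≠ 0) :
    typeRank G (sigmaType Φ) ≠ Fintype.card (Σ i, E i) / 2 + 1 :=
  (typeRank_sigmaType_lt_of_shared h h01 χ f₀ f₁ hf₀ hf₁ hc₀ hc₁).ne

/-- **No partial conjugation can exist in this situation** (contrapositive of rank additivity): under a shared character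
with non-zero pairings there is a slot without partial conjugation — for CM fields: `L_i ∩ ∏_{j≠i} L_j` is not totally
real for some `i`. [cite: Gordon1999HodgeAVSurvey, §3 Theorem (proof)] -/
theorem not_forall_exists_partialConj_of_shared [Nonempty I] [∀ i, Nonempty (E i)] {ρ : G} {Φ : ∀ i, Set (E i)}
    (h : ∀ i, IsCMTypeWith ρ (Φ i)) {i₀ i₁ : I} (h01 : i₀ ≠ i₁) (χ : G → ℚ) (f₀ : E i₀ → ℚ) (f₁ : E i₁ → ℚ)
    (hf₀ : ∀ (g : G) (x : E i₀), f₀ (g • x) = χ g * f₀ x) (hf₁ : ∀ (g : G) (x : E i₁), f₁ (g • x) = χ g * f₁ x)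
    (hc₀ : ∑ x, f₀ x * antiVec (Φ i₀) (1 : G) x ≠ 0) (hc₁ : ∑ x, f₁ x * antiVec (Φ i₁) (1 : G) x ≠ 0) :
    ¬ ∀ i, ∃ σ : G, (∀ s : E i, σ • s = ρ • s) ∧ ∀ j, j ≠ i → ∀ s : E j, σ • s = s := fun hconj => by
  have h1 := typeRank_sigmaType_add_card_eq_of_partialConj h hconj
  have h2 := typeRank_sigmaType_add_card_lt_of_shared h h01 χ f₀ f₁ hf₀ hf₁ hc₀ hc₁
  omega

end Shared

end Literature.NumberTheory.ComplexMultiplication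

end
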